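import Literature.RepresentationTheory.HeisenbergGroup.DualLatticePairFiniteAdelic
import Literature.NumberTheory.Automorphic.AdeleAddCharLocalComponentsUnramified
import Literature.NumberTheory.Automorphic.AdicCompletionCompact
import HarnessLib

/-!
# The finite-adelic dual lattice pair `((∏ 𝒪_v)ⁿ, (∏ 𝔠_{ψ_v})ⁿ)` of a number field and a global additive character

Topic `NumberTheory/Automorphic`; theorems only (no definition, no named fact).

`RepresentationTheory/HeisenbergGroup/DualLatticePairFiniteAdelic` proves, for an ABSTRACT restricted
product `P = Πʳ_v [F_v, A_v]` of non-archimedean normed fields with compact unit balls `A_v` and local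
characters `ψ_v` (continuous, non-trivial, unramified almost everywhere), that the boxes
`((∏ 𝒪_v)ⁿ, (∏ 𝔠_{ψ_v})ⁿ)` form a dual lattice pair for the dot product `(∏ψ_v)(x · y)` with shrinking unit
scalings — the input `(hB, hX, hY)` of the finite-adelic half of the uniqueness of `ρ_ψ`
(`AdelicShapeUniqueness.exists_linearIsometryEquiv_of_irreducible_adelicShape`; [GelbartRogawski1991,
§3.1 p. 454 L20–21] "(`ρ_ψ` is unique up to isomorphism)").  This file DISCHARGES every hypothesis of
that theorem for the honest objects: `F_v = v.adicCompletion K`, `A_v = v.adicCompletionIntegers K`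
(so `P` is, by definition, Mathlib's `FiniteAdeleRing (𝓞 K) K`) and `ψ_v = ψ.adicComponent v` the local
components of an ARBITRARY global additive character `ψ` of the number field `K` (`IsGlobalAddChar K ψ`,
e.g. the `ψ` of `GelbartRogawski1991.Prop311AsPrinted`):
* the norm dictionary on `K_v` (Mathlib `Valued.toNormedField`): `𝒪_v = closedBall 0 1`
  (`coe_adicCompletionIntegers_eq_closedBall`), a uniformiser has `0 < ‖ϖ‖ < 1`
  (`exists_norm_pos_norm_lt_one`), and conductor exponent `0` means `𝔠_{ψ_v} = 𝒪_v`
  (`coe_mulDual_eq_closedBall_of_hasConductorExp_zero`);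
* `ψ_v` continuous, non-trivial at EVERY `v` (`AdeleAddCharLocalComponentsNontrivial`), trivial on `𝒪_v`
  and of conductor exponent `0` for almost all `v` (`AdeleAddCharClassification`,
  `AdeleAddCharLocalComponentsUnramified`);
* hence (Weil, *Basic Number Theory*, Chap. IV §2, Cor. 3 of Th. 3: *"for almost all finite places `v`
  of `k`, `ε'_v` is the dual `k_v`-lattice to `ε_v`"*, the adelic self-dual lattice)
  **`isDualLatticePair_finiteAdele_integers_conductor_pi`** and the scaling lemmas
  `exists_units_smul_finiteAdele_integers_pi_subset`, `exists_units_smul_finiteAdele_conductor_pi_subset`.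

## References

* A. Weil, *Basic Number Theory* (1967), Chap. IV §2, Corollary 3 of Theorem 3. [WeilBNT1967]
* A. Weil, *Sur certains groupes d'opérateurs unitaires*, Acta Math. 111 (1964), Chap. III n° 37–39. [Weil1964]
* S. Gelbart, J. Rogawski, Invent. Math. 105 (1991), §3.1 p. 454 L17–27. [GelbartRogawski1991]
-/

noncomputable section

open NumberField IsDedekindDomain Filter Topology
open Literature.RepresentationTheory.HeisenbergGroup Literature.RepresentationTheory.HeisenbergGroup.RestrictedPair
open Literature.NumberTheory.GaloisRepresentations.IsNonarchimedeanLocalField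
open scoped Pointwise RestrictedProduct

namespace Literature.NumberTheory.Automorphic

variable (K : Type) [Field K] [NumberField K]

/-! ### The norm dictionary on `K_v` -/

/-- `𝒪_v` is the closed unit ball of `K_v` (Mathlib's norm `Valued.toNormedField` on `v.adicCompletion K`).
[folklore] -/
private theorem coe_adicCompletionIntegers_eq_closedBall (v : HeightOneSpectrum (𝓞 K)) :
    ((v.adicCompletionIntegers K : Set (v.adicCompletion K))) = Metric.closedBall 0 1 := by
  ext x
  rw [SetLike.mem_coe, HeightOneSpectrum.mem_adicCompletionIntegers, Metric.mem_closedBall, dist_zero_right,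
    Valued.toNormedField.norm_le_one_iff]

/-- a uniformiser: an element of `K_v` with `0 < ‖ϖ‖ < 1`. [folklore] -/
private theorem exists_norm_pos_norm_lt_one (v : HeightOneSpectrum (𝓞 K)) :
    ∃ c : v.adicCompletion K, 0 < ‖c‖ ∧ ‖c‖ < 1 := by
  obtain ⟨π, hπ0, hπ⟩ := exists_coe_valued_eq_exp_neg_one v
  refine ⟨(π : v.adicCompletion K), ?_, ?_⟩
  · rw [norm_pos_iff]
    intro h
    rw [h, map_zero] at hπ
    exact WithZero.zero_ne_coe hπ
  · rw [Valued.toNormedField.norm_lt_one_iff, hπ, ← WithZero.exp_zero, WithZero.exp_lt_exp]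
    norm_num

variable {K} in
/-- **conductor exponent `0` means `𝔠_ψ = 𝒪_v`**: for a local character `φ` of `K_v` trivial on `𝒪_v` and
not on `𝔭_v⁻¹`, the conductor lattice `mulDual φ = {t ; φ(s t) = 1 ∀ ‖s‖ ≤ 1}` is the closed unit ball.
[folklore] -/
private theorem coe_mulDual_eq_closedBall_of_hasConductorExp_zero {v : HeightOneSpectrum (𝓞 K)}
    {φ : AddChar (v.adicCompletion K) Circle} (h : φ.HasConductorExp 0) :
    (mulDual φ : Set (v.adicCompletion K)) = Metric.closedBall 0 1 := by
  ext t
  rw [SetLike.mem_coe, mem_mulDual, Metric.mem_closedBall, dist_zero_right,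
    Valued.toNormedField.norm_le_one_iff]
  constructor
  · intro ht
    by_contra hvt
    push Not at hvt
    -- `v(t) ≥ q`: write `v t = exp n`, `n ≥ 1`
    have ht0 : t ≠ 0 := fun h0 => by
      rw [h0, map_zero] at hvt
      exact not_lt_of_ge zero_le hvt
    obtain ⟨n, hn⟩ : ∃ n : ℤ, Valued.v t = WithZero.exp n :=
      ⟨_, (WithZero.coe_unzero ((Valuation.ne_zero_iff _).mpr ht0)).symm⟩
    have hn1 : 1 ≤ n := by
      rw [hn, ← WithZero.exp_zero, WithZero.exp_lt_exp] at hvt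
      omega
    -- a witness `x ∈ 𝔭⁻¹` with `φ x ≠ 1`, and `s = x t⁻¹ ∈ 𝒪_v`
    obtain ⟨x, hx, hφx⟩ := h.2
    rw [mem_primePowBall_adicCompletion_iff v] at hx
    have hs : Valued.v (x * t⁻¹) ≤ 1 := by
      rw [map_mul, map_inv₀, hn]
      calc Valued.v x * (WithZero.exp n)⁻¹ ≤ WithZero.exp (-(0 - 1 : ℤ)) * (WithZero.exp n)⁻¹ :=
            mul_le_mul' hx le_rfl
        _ ≤ 1 := by
            rw [← WithZero.exp_neg, ← WithZero.exp_add, ← WithZero.exp_zero, WithZero.exp_le_exp]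
            omega
    have := ht _ (Valued.toNormedField.norm_le_one_iff.mpr hs)
    rw [inv_mul_cancel_right₀ ht0] at this
    exact hφx this
  · intro ht s hs
    refine h.1 _ ?_
    rw [mem_primePowBall_adicCompletion_iff v, map_mul, neg_zero, WithZero.exp_zero]
    exact mul_le_one' (Valued.toNormedField.norm_le_one_iff.mp hs) ht

/-! ### The finite-adelic dual lattice pair of `K` and `ψ` -/

section Pair

variable {K}
variable {ψ : AddChar (AdeleRing (𝓞 K) K) Circle}

/-- the local components are continuous. [folklore] -/
private theorem continuous_adicComponent' (hψ : IsGlobalAddChar K ψ) (v : HeightOneSpectrum (𝓞 K)) :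
    Continuous (ψ.adicComponent v) :=
  hψ.continuous_adicComponent v

/-- the local components are non-trivial. [cite: WeilBNT1967, Chap. IV §2, Cor. 1 of Th. 3] -/
private theorem exists_adicComponent_ne_one (hψ : IsGlobalAddChar K ψ) (v : HeightOneSpectrum (𝓞 K)) :
    ∃ t, ψ.adicComponent v t ≠ 1 :=
  AddChar.ne_one_iff.mp (hψ.adicComponent_ne_one v)

/-- `𝔠_{ψ_v} = 𝒪_v` for almost all `v`. [cite: WeilBNT1967, Chap. IV §2, Cor. 1 of Th. 3] -/
private theorem eventually_coe_mulDual_adicComponent_eq_closedBall (hψ : IsGlobalAddChar K ψ) :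
    ∀ᶠ v : HeightOneSpectrum (𝓞 K) in cofinite,
      (mulDual (ψ.adicComponent v) : Set (v.adicCompletion K)) = Metric.closedBall 0 1 :=
  hψ.eventually_hasConductorExp_zero_adicComponent.mono fun _ hv =>
    coe_mulDual_eq_closedBall_of_hasConductorExp_zero hv

/-- **The finite-adelic dual lattice pair of a number field `K` and a global additive character `ψ`, in rank
`n`**: the boxes `((∏_v 𝒪_v)ⁿ, (∏_v 𝔠_{ψ_v})ⁿ)` in `(𝔸_K^∞)ⁿ × (𝔸_K^∞)ⁿ`,
`𝔸_K^∞ = Πʳ_v [K_v, 𝒪_v] = FiniteAdeleRing (𝓞 K) K`, form a dual lattice pair for the dot product and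
the character `∏ᶠ_v ψ_v = ψ|_{𝔸_K^∞}` (`AdeleAddCharProductFormula`) — hypothesis `hB` of
`StoneVonNeumannLatticePair` / `HeisenbergPairUniqueness` / `AdelicShapeUniqueness` for the finite-adelic
Heisenberg group of `K` in a Darboux basis. [cite: WeilBNT1967, Chap. IV §2, Cor. 3 of Th. 3] -/
theorem isDualLatticePair_finiteAdele_integers_conductor_pi (hψ : IsGlobalAddChar K ψ)
    {n : Type*} [Fintype n] [DecidableEq n] :
    IsDualLatticePair
      (Matrix.toLinearMap₂' (Πʳ v : HeightOneSpectrum (𝓞 K), [v.adicCompletion K, v.adicCompletionIntegers K])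
        (1 : Matrix n n (Πʳ v : HeightOneSpectrum (𝓞 K), [v.adicCompletion K, v.adicCompletionIntegers K])))
      (prodChar (A := fun v : HeightOneSpectrum (𝓞 K) => v.adicCompletionIntegers K)
        (fun v => ψ.adicComponent v) (eventually_forall_adicComponent_apply_eq_one hψ.continuous))
      (AddSubgroup.pi Set.univ fun _ : n =>
        box (A := fun v : HeightOneSpectrum (𝓞 K) => v.adicCompletionIntegers K) fun v =>
          (IsUltrametricDist.closedBall_openAddSubgroup (v.adicCompletion K) one_pos).toAddSubgroup)
      (AddSubgroup.pi Set.univ fun _ : n =>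
        box (A := fun v : HeightOneSpectrum (𝓞 K) => v.adicCompletionIntegers K) fun v =>
          mulDual (ψ.adicComponent v)) := by
  classical
  haveI : ∀ v : HeightOneSpectrum (𝓞 K), ProperSpace (v.adicCompletion K) :=
    fun v => properSpace_adicCompletion K v
  exact isDualLatticePair_integers_conductor_pi (coe_adicCompletionIntegers_eq_closedBall K)
    (fun v => ψ.adicComponent v) (continuous_adicComponent' hψ) (exists_adicComponent_ne_one hψ)
    (eventually_forall_adicComponent_apply_eq_one hψ.continuous)
    (eventually_coe_mulDual_adicComponent_eq_closedBall hψ)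

/-- **the unit scalings of `(∏ 𝒪_v)ⁿ` shrink to `0`** in `(𝔸_K^∞)ⁿ` — hypothesis `hX` of the lattice-pair
uniqueness theorems for the finite adeles of `K`. [cite: Weil1964, Chap. III n° 37–39] -/
theorem exists_units_smul_finiteAdele_integers_pi_subset {n : Type*} [Fintype n]
    (N : Set (n → Πʳ v : HeightOneSpectrum (𝓞 K), [v.adicCompletion K, v.adicCompletionIntegers K]))
    (hN : N ∈ 𝓝 (0 : n → Πʳ v : HeightOneSpectrum (𝓞 K), [v.adicCompletion K, v.adicCompletionIntegers K])) :
    ∃ u : (Πʳ v : HeightOneSpectrum (𝓞 K), [v.adicCompletion K, v.adicCompletionIntegers K])ˣ,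
      (((u : Πʳ v : HeightOneSpectrum (𝓞 K), [v.adicCompletion K, v.adicCompletionIntegers K]) •
        AddSubgroup.pi Set.univ (fun _ : n =>
          box (A := fun v : HeightOneSpectrum (𝓞 K) => v.adicCompletionIntegers K) fun v =>
            (IsUltrametricDist.closedBall_openAddSubgroup (v.adicCompletion K) one_pos).toAddSubgroup) :
        AddSubgroup (n → Πʳ v : HeightOneSpectrum (𝓞 K), [v.adicCompletion K, v.adicCompletionIntegers K])) :
        Set (n → Πʳ v : HeightOneSpectrum (𝓞 K), [v.adicCompletion K, v.adicCompletionIntegers K])) ⊆ N :=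
  exists_units_smul_integers_pi_subset (coe_adicCompletionIntegers_eq_closedBall K)
    (exists_norm_pos_norm_lt_one K) N hN

/-- **the unit scalings of `(∏ 𝔠_{ψ_v})ⁿ` shrink to `0`** in `(𝔸_K^∞)ⁿ` — hypothesis `hY` of the lattice-pair
uniqueness theorems for the finite adeles of `K` and a global additive character `ψ`.
[cite: Weil1964, Chap. III n° 37–39] -/
theorem exists_units_smul_finiteAdele_conductor_pi_subset (hψ : IsGlobalAddChar K ψ) {n : Type*} [Fintype n]
    (N : Set (n → Πʳ v : HeightOneSpectrum (𝓞 K), [v.adicCompletion K, v.adicCompletionIntegers K]))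
    (hN : N ∈ 𝓝 (0 : n → Πʳ v : HeightOneSpectrum (𝓞 K), [v.adicCompletion K, v.adicCompletionIntegers K])) :
    ∃ u : (Πʳ v : HeightOneSpectrum (𝓞 K), [v.adicCompletion K, v.adicCompletionIntegers K])ˣ,
      (((u : Πʳ v : HeightOneSpectrum (𝓞 K), [v.adicCompletion K, v.adicCompletionIntegers K]) •
        AddSubgroup.pi Set.univ (fun _ : n =>
          box (A := fun v : HeightOneSpectrum (𝓞 K) => v.adicCompletionIntegers K) fun v =>
            mulDual (ψ.adicComponent v)) :
        AddSubgroup (n → Πʳ v : HeightOneSpectrum (𝓞 K), [v.adicCompletion K, v.adicCompletionIntegers K])) :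
        Set (n → Πʳ v : HeightOneSpectrum (𝓞 K), [v.adicCompletion K, v.adicCompletionIntegers K])) ⊆ N := by
  haveI : ∀ v : HeightOneSpectrum (𝓞 K), ProperSpace (v.adicCompletion K) :=
    fun v => properSpace_adicCompletion K v
  exact exists_units_smul_conductor_pi_subset (coe_adicCompletionIntegers_eq_closedBall K)
    (fun v => ψ.adicComponent v) (continuous_adicComponent' hψ) (exists_adicComponent_ne_one hψ)
    (eventually_coe_mulDual_adicComponent_eq_closedBall hψ) (exists_norm_pos_norm_lt_one K) N hN

end Pair

end Literature.NumberTheory.Automorphic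

end
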